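import Literature.RingTheory.FittingIdeal.ConstantRank
import Literature.RingTheory.FittingIdeal.BaseChange
import Literature.RingTheory.FittingIdeal.Monotone
import Mathlib.RingTheory.Flat.EquationalCriterion
import Mathlib.RingTheory.Flat.Localization
import Mathlib.RingTheory.LocalProperties.FinitePresentation
import Mathlib.RingTheory.Support
import Mathlib.Algebra.Module.LocalizedModule.Submodule
import Mathlib.RingTheory.Spectrum.Prime.FreeLocus
import HarnessLib

/-!
# The rank-`r` locus: `Fit_{r-1}(M) = 0`, `Fit_r(M) = R` characterises finite locally free
# modules of rank `r`, compatibly with base change (Stacks 07ZD global form, 0C3G, 05P8 (3))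

Topic: `Literature/RingTheory/FittingIdeal`.  THEOREMS ONLY.  The Stacks Project, Tag 07ZD
(More on Algebra, Lemma 15.8.8): "Let `R` be a ring. Let `M` be a finite `R`-module. Let `r ≥ 0`.
The following are equivalent (1) `M` is finite locally free of rank `r`, (2) `Fit_{r-1}(M) = 0` and
`Fit_r(M) = R`, and (3) `Fit_k(M) = 0` for `k < r` and `Fit_k(M) = R` for `k ≥ r`."; globalised
on a scheme as Tag 0C3G (Divisors, Lemma 31.9.5) and turned into a statement about ALL base
changes in Tag 05P8 (Divisors, Lemma 31.9.6 (3)): "The functor `F_r : (Sch/S)^opp → Sets`,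
`T ↦ {∗}` if `F_T` locally free rank `r`, `∅` otherwise, is representable by the locally closed
subscheme `Z_{r-1} ∖ Z_r` of `S`" (`Z_k = V(Fit_k(F))`), whose proof is "for any morphism
`g : T → S` we see from Lemmas 31.9.1 [`f⁻¹Fit_i(F)·𝒪_T = Fit_i(f^*F)`, Tag 0C3D] and 31.9.5 that
`F_T` is free of rank `r` if and only if `Fit_r(F)·𝒪_T = 𝒪_T` and `Fit_{r-1}(F)·𝒪_T = 0`."

The tree already has the LOCAL-RING case of 07ZD (★ `Module.nonempty_basis_iff_fittingIdeal`,
`LocallyFree.lean`), the direction "finite flat of constant rank `r` ⇒ Fitting conditions"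
(★ `ConstantRank.lean`), "Fitting ideals commute with localisation / base change" (★
`Module.fittingIdeal_of_isLocalizedModule`, `Module.fittingIdeal_baseChange`, Tag 07ZA) and the
field case (★ `FreeModule.lean`).  This file proves the converse for a FINITE module over an
arbitrary ring and assembles the RING-LEVEL content of 0C3G / 05P8 (3) in Mathlib's currency for
"finite locally free of rank `r`" — `Module.Projective` with `Module.rankAtStalk M = r` (the
currency of Mathlib's `Module.Grassmannian`), equivalently `Module.Flat` with constant rank:

* §1 `Module.nonempty_basis_localizedModule_of_fittingIdeal`, `Module.rankAtStalk_eq_of_fittingIdeal`,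
  `Module.flat_of_fittingIdeal` (every `M_𝔭` is free of rank `r`, so `M` is flat of constant rank),
  **`Module.flat_and_rankAtStalk_eq_iff_fittingIdeal`**, `Module.forall_lt_fittingIdeal_eq_bot_iff`.
* §2 ZARISKI-LOCAL FREENESS without a finite-presentation hypothesis (the printed proof of 07ZD via
  07ZC): `Module.exists_span_image_eq_top_away` (generators of `M_𝔭` generate some `M_f`, `f ∉ 𝔭`),
  **`Module.exists_nonempty_basis_away_of_fittingIdeal`** (`M_f` free of rank `r` on a basic open
  cover), `Module.finitePresentation_of_fittingIdeal`, `Module.projective_of_fittingIdeal`, and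
  **`Module.projective_and_rankAtStalk_eq_iff_fittingIdeal`** (07ZD for a finite module).
* §3 BASE CHANGE (the content of 05P8 (3) one `T = Spec S` at a time): for an `R`-algebra `S`,
  **`Module.projective_and_rankAtStalk_eq_baseChange_iff`** / **`…_iff_le_ker`** (and flat twins):
  `S ⊗[R] M` is projective of constant rank `r` over `S` iff `Fit_r(M)·S = S` and
  `Fit_k(M) ⊆ ker (R → S)` for `k < r` (`R → S` factors through `R / Fit_{r-1}(M)` and inverts
  `Fit_r(M)`); two ranks cannot occur over a non-trivial `S` (`Module.eq_of_fittingIdeal_map_eq`).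
* §4 FIBRE RANKS (Tag 07ZC at a prime): `Module.fittingIdeal_le_iff_lt_finrank_fiber`,
  `Module.not_fittingIdeal_le_iff_finrank_fiber_le`, and
  **`Module.finrank_fiber_eq_iff_fittingIdeal`**: the fibre rank `dim_{κ(𝔭)} (κ(𝔭) ⊗ M)` equals `r`
  iff `Fit_k(M) ⊆ 𝔭 (k < r)` and `Fit_r(M) ⊄ 𝔭`: `Spec R` is partitioned by the locally closed
  strata `V(Fit_{r-1}) ∖ V(Fit_r)` (05P8 (1) set-theoretically).

Cell `hodgecm-mathlib` (D-0151) count-neutral Mathlib-side capital (F-DAG F-5 (5b)/(5d):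
flattening stratification of a finitely presented module, `Hilb ↪ Grass`); nothing here is about
HC — HC_CM is proved only modulo the 7 printed citations until rung 0 closes.

## References

* The Stacks Project, Tags 07ZD, 07ZC, 07ZA (§15.8), 0C3G, 0C3D, 05P8 (§31.9). [StacksProject]
-/

namespace Literature.RingTheory.FittingIdeal

open TensorProduct

universe u v w

variable {R : Type u} [CommRing R] {M : Type v} [AddCommGroup M] [Module R M]

/-! ## §1 Stacks 07ZD over an arbitrary ring -/

/-- The two-ideal form of the vanishing condition: `Fit_k(M) = 0` for all `k < r + 1` iff
`Fit_r(M) = 0` (monotonicity of the Fitting ideals, Stacks 07ZA (2)). [cite: StacksProject, Tag 07ZD] -/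
theorem Module.forall_lt_fittingIdeal_eq_bot_iff {r : ℕ} :
    (∀ k < r + 1, Module.fittingIdeal R M k = ⊥) ↔ Module.fittingIdeal R M r = ⊥ := by
  refine ⟨fun h => h r (Nat.lt_succ_self r), fun h k hk => ?_⟩
  exact le_bot_iff.mp (h ▸ Module.fittingIdeal_mono (Nat.le_of_lt_succ hk))

/-- The Fitting conditions `Fit_r = R`, `Fit_k = 0 (k < r)` are preserved by any base change
`S ⊗[R] M` (Stacks 07ZA (3): `Fit_k(S ⊗ M) = Fit_k(M)·S`). [cite: StacksProject, Tag 07ZA] -/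
theorem Module.fittingIdeal_baseChange_of_fittingIdeal [Module.Finite R M] {r : ℕ}
    (htop : Module.fittingIdeal R M r = ⊤) (hbot : ∀ k < r, Module.fittingIdeal R M k = ⊥)
    (S : Type w) [CommRing S] [Algebra R S] :
    Module.fittingIdeal S (S ⊗[R] M) r = ⊤ ∧ ∀ k < r, Module.fittingIdeal S (S ⊗[R] M) k = ⊥ := by
  refine ⟨?_, fun k hk => ?_⟩
  · rw [Module.fittingIdeal_baseChange, htop, Ideal.map_top]
  · rw [Module.fittingIdeal_baseChange, hbot k hk, Ideal.map_bot]

/-- **Stacks 07ZD at a prime**: if `Fit_r(M) = R` and `Fit_k(M) = 0` for `k < r` (`M` finite), then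
the localisation `M_𝔭` at any prime `𝔭` is free of rank `r` — Fitting ideals commute with
localisation (07ZA (3)) and the local-ring case of 07ZD. [cite: StacksProject, Tag 07ZD] -/
theorem Module.nonempty_basis_localizedModule_of_fittingIdeal [Module.Finite R M] {r : ℕ}
    (htop : Module.fittingIdeal R M r = ⊤) (hbot : ∀ k < r, Module.fittingIdeal R M k = ⊥)
    (p : PrimeSpectrum R) :
    Nonempty (Module.Basis (Fin r) (Localization.AtPrime p.asIdeal)
      (LocalizedModule p.asIdeal.primeCompl M)) := by
  haveI : Module.Finite (Localization.AtPrime p.asIdeal)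
      (LocalizedModule p.asIdeal.primeCompl M) :=
    Module.Finite.of_isLocalizedModule p.asIdeal.primeCompl (LocalizedModule.mkLinearMap _ _)
  refine Module.nonempty_basis_of_fittingIdeal ?_ fun k hk => ?_
  · rw [Module.fittingIdeal_of_isLocalizedModule p.asIdeal.primeCompl
      (Localization.AtPrime p.asIdeal) (LocalizedModule.mkLinearMap p.asIdeal.primeCompl M) r,
      htop, Ideal.map_top]
  · rw [Module.fittingIdeal_of_isLocalizedModule p.asIdeal.primeCompl
      (Localization.AtPrime p.asIdeal) (LocalizedModule.mkLinearMap p.asIdeal.primeCompl M) k,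
      hbot k hk, Ideal.map_bot]

/-- **The rank at every stalk is `r`** under the Fitting conditions `Fit_r(M) = R`,
`Fit_k(M) = 0 (k < r)` (`M` finite). [cite: StacksProject, Tag 07ZD] -/
theorem Module.rankAtStalk_eq_of_fittingIdeal [Module.Finite R M] {r : ℕ}
    (htop : Module.fittingIdeal R M r = ⊤) (hbot : ∀ k < r, Module.fittingIdeal R M k = ⊥)
    (p : PrimeSpectrum R) : Module.rankAtStalk M p = r := by
  obtain ⟨b⟩ := Module.nonempty_basis_localizedModule_of_fittingIdeal htop hbot p
  rw [Module.rankAtStalk, Module.finrank_eq_card_basis b, Fintype.card_fin]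

/-- **Every localisation at a prime is free** under the Fitting conditions (`M` finite).
[cite: StacksProject, Tag 07ZD] -/
theorem Module.free_localizedModule_of_fittingIdeal [Module.Finite R M] {r : ℕ}
    (htop : Module.fittingIdeal R M r = ⊤) (hbot : ∀ k < r, Module.fittingIdeal R M k = ⊥)
    (p : PrimeSpectrum R) :
    Module.Free (Localization.AtPrime p.asIdeal) (LocalizedModule p.asIdeal.primeCompl M) := by
  obtain ⟨b⟩ := Module.nonempty_basis_localizedModule_of_fittingIdeal htop hbot p
  exact Module.Free.of_basis b

/-- **A finite module satisfying the Fitting conditions is flat** (it is free at every maximal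
ideal; flatness is local). [cite: StacksProject, Tag 07ZD] -/
theorem Module.flat_of_fittingIdeal [Module.Finite R M] {r : ℕ}
    (htop : Module.fittingIdeal R M r = ⊤) (hbot : ∀ k < r, Module.fittingIdeal R M k = ⊥) :
    Module.Flat R M := by
  refine Module.flat_of_localized_maximal (R := R) (M := M) fun P hP => ?_
  haveI := hP.isPrime
  haveI := Module.free_localizedModule_of_fittingIdeal htop hbot ⟨P, hP.isPrime⟩
  exact Module.Flat.trans R (Localization.AtPrime P) (LocalizedModule P.primeCompl M)

/-- **Stacks 07ZD for a finite module, flat currency**: a finite `R`-module `M` is flat with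
`rank_𝔭(M) = r` at every prime iff `Fit_r(M) = R` and `Fit_k(M) = 0` for all `k < r`.
(Finite flat modules are free at every prime, Stacks 00NZ; the forward direction is ★
`ConstantRank.lean`.) [cite: StacksProject, Tag 07ZD] -/
theorem Module.flat_and_rankAtStalk_eq_iff_fittingIdeal [Module.Finite R M] {r : ℕ} :
    (Module.Flat R M ∧ ∀ p : PrimeSpectrum R, Module.rankAtStalk M p = r) ↔
      Module.fittingIdeal R M r = ⊤ ∧ ∀ k < r, Module.fittingIdeal R M k = ⊥ := by
  constructor
  · rintro ⟨hflat, hr⟩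
    exact ⟨Module.fittingIdeal_eq_top_of_rankAtStalk_eq hr,
      fun k hk => Module.fittingIdeal_eq_bot_of_lt_rankAtStalk fun p => (hr p).symm ▸ hk⟩
  · rintro ⟨htop, hbot⟩
    exact ⟨Module.flat_of_fittingIdeal htop hbot, Module.rankAtStalk_eq_of_fittingIdeal htop hbot⟩

/-! ## §2 Finite modules: Zariski-local freeness from the Fitting conditions (07ZD (2) ⇒ (1))

The Stacks proof of 07ZD: `Fit_r(M) = R` makes `M` locally generated by `r` elements (07ZC), and
`Fit_{r-1}(M) = 0` makes any `r` generators free; so `M_f` is free of rank `r` on a basic open cover,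
and `M` is finitely presented and projective (no finite-presentation hypothesis). -/

section Spread

/-- **Spreading out generators** (the step (3) ⇒ (4) of Stacks 07ZC): if the images of a family
`m i` of elements of a finite module `M` generate the localisation `M_𝔭`, then they already
generate `M_f` for some `f ∉ 𝔭` — the cokernel `N = M ⧸ ⟨m i⟩` is a finite module with `N_𝔭 = 0`,
hence `N_f = 0` for some `f ∉ 𝔭` (`LocalizedModule.exists_subsingleton_away`).
[cite: StacksProject, Tag 07ZC] -/
theorem Module.exists_span_image_eq_top_away [Module.Finite R M] (p : PrimeSpectrum R)
    {ι : Type*} (m : ι → M)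
    (hm : Submodule.span (Localization.AtPrime p.asIdeal)
      (LocalizedModule.mkLinearMap p.asIdeal.primeCompl M '' Set.range m) = ⊤) :
    ∃ f ∉ p.asIdeal, Submodule.span (Localization.Away f)
      (LocalizedModule.mkLinearMap (Submonoid.powers f) M '' Set.range m) = ⊤ := by
  set W : Submodule R M := Submodule.span R (Set.range m) with hW
  -- the cokernel `M ⧸ W` vanishes at `𝔭`
  haveI : Subsingleton (LocalizedModule p.asIdeal.primeCompl (M ⧸ W)) := by
    refine LocalizedModule.subsingleton_iff.mpr fun n => ?_
    obtain ⟨x, rfl⟩ := Submodule.mkQ_surjective W n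
    have hx : LocalizedModule.mkLinearMap p.asIdeal.primeCompl M x ∈
        W.localized' (Localization.AtPrime p.asIdeal) p.asIdeal.primeCompl
          (LocalizedModule.mkLinearMap p.asIdeal.primeCompl M) := by
      rw [hW, Submodule.localized'_span, hm]
      exact Submodule.mem_top
    obtain ⟨w, hw, s, hs⟩ := (Submodule.mem_localized' _ _ _ _ _).mp hx
    rw [IsLocalizedModule.mk'_eq_iff, Submonoid.smul_def, ← map_smul] at hs
    obtain ⟨c, hc⟩ := (IsLocalizedModule.eq_iff_exists p.asIdeal.primeCompl _).mp hs
    rw [Submonoid.smul_def, Submonoid.smul_def] at hc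
    refine ⟨(c : R) * s, (c * s).2, ?_⟩
    rw [mul_smul, Submodule.mkQ_apply, ← Submodule.Quotient.mk_smul, ← Submodule.Quotient.mk_smul,
      Submodule.Quotient.mk_eq_zero, ← hc]
    exact W.smul_mem _ hw
  obtain ⟨f, hf, hN⟩ := LocalizedModule.exists_subsingleton_away (M := M ⧸ W) p.asIdeal
  refine ⟨f, hf, ?_⟩
  rw [← Submodule.localized'_span (Localization.Away f) (Submonoid.powers f)
    (LocalizedModule.mkLinearMap (Submonoid.powers f) M), ← hW, eq_top_iff]
  rintro y -
  obtain ⟨⟨x, t⟩, rfl⟩ := IsLocalizedModule.mk'_surjective (Submonoid.powers f)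
    (LocalizedModule.mkLinearMap (Submonoid.powers f) M) y
  obtain ⟨u, hu, hux⟩ := (LocalizedModule.subsingleton_iff.mp hN) (W.mkQ x)
  rw [Submodule.mkQ_apply, ← Submodule.Quotient.mk_smul, Submodule.Quotient.mk_eq_zero] at hux
  refine (Submodule.mem_localized' _ _ _ _ _).mpr ⟨u • x, hux, ⟨u, hu⟩ * t, ?_⟩
  exact IsLocalizedModule.mk'_cancel_left (LocalizedModule.mkLinearMap (Submonoid.powers f) M)
    x ⟨u, hu⟩ t

/-- **Stacks 07ZD (2) ⇒ (1), Zariski form**: under the Fitting conditions `Fit_r(M) = R`,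
`Fit_k(M) = 0 (k < r)` on a finite module `M`, every prime `𝔭` has a basic open neighbourhood
`D(f) ∋ 𝔭` over which `M_f` is free of rank `r` ("`M` is finite locally free of rank `r`").
[cite: StacksProject, Tag 07ZD] -/
theorem Module.exists_nonempty_basis_away_of_fittingIdeal [Module.Finite R M] {r : ℕ}
    (htop : Module.fittingIdeal R M r = ⊤) (hbot : ∀ k < r, Module.fittingIdeal R M k = ⊥)
    (p : PrimeSpectrum R) :
    ∃ f ∉ p.asIdeal, Nonempty (Module.Basis (Fin r) (Localization.Away f)
      (LocalizedModule (Submonoid.powers f) M)) := by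
  obtain ⟨b⟩ := Module.nonempty_basis_localizedModule_of_fittingIdeal htop hbot p
  set mk := LocalizedModule.mkLinearMap p.asIdeal.primeCompl M with hmk
  choose xt hxt using fun i => IsLocalizedModule.surj p.asIdeal.primeCompl mk (b i)
  let x : Fin r → M := fun i => (xt i).1
  have hspan : Submodule.span (Localization.AtPrime p.asIdeal) (mk '' Set.range x) = ⊤ := by
    rw [eq_top_iff, ← b.span_eq, Submodule.span_le]
    rintro _ ⟨i, rfl⟩
    have hu := IsLocalization.map_units (Localization.AtPrime p.asIdeal) (xt i).2
    have key : hu.unit • b i = mk (x i) := by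
      rw [Units.smul_def, IsUnit.unit_spec, algebraMap_smul, ← Submonoid.smul_def]
      exact hxt i
    rw [SetLike.mem_coe, ← inv_smul_smul hu.unit (b i), key, Units.smul_def]
    exact Submodule.smul_mem _ _ (Submodule.subset_span ⟨x i, ⟨i, rfl⟩, rfl⟩)
  obtain ⟨f, hf, hspan'⟩ := Module.exists_span_image_eq_top_away p x hspan
  refine ⟨f, hf, ?_⟩
  haveI : Module.Finite (Localization.Away f) (LocalizedModule (Submonoid.powers f) M) :=
    Module.Finite.of_isLocalizedModule (Submonoid.powers f) (LocalizedModule.mkLinearMap _ _)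
  have hrange : Submodule.span (Localization.Away f)
      (Set.range (LocalizedModule.mkLinearMap (Submonoid.powers f) M ∘ x)) = ⊤ := by
    rw [Set.range_comp]
    exact hspan'
  have hbot' : ∀ k < r, Module.fittingIdeal (Localization.Away f)
      (LocalizedModule (Submonoid.powers f) M) k = ⊥ := fun k hk => by
    rw [Module.fittingIdeal_of_isLocalizedModule (Submonoid.powers f) (Localization.Away f)
      (LocalizedModule.mkLinearMap (Submonoid.powers f) M) k, hbot k hk, Ideal.map_bot]
  exact ⟨Module.Basis.mk (Module.linearIndependent_of_fittingIdeal_eq_bot _ hrange hbot')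
    (le_of_eq hrange.symm)⟩

/-- **A finite module satisfying the Fitting conditions is finitely presented** (it is free on a
cover of `Spec R` by basic opens; finite presentation is Zariski-local). [cite: StacksProject, Tag 07ZD] -/
theorem Module.finitePresentation_of_fittingIdeal [Module.Finite R M] {r : ℕ}
    (htop : Module.fittingIdeal R M r = ⊤) (hbot : ∀ k < r, Module.fittingIdeal R M k = ⊥) :
    Module.FinitePresentation R M := by
  let s : Set R := {f | Module.Free (Localization.Away f) (LocalizedModule (Submonoid.powers f) M)}
  have hs : Ideal.span s = ⊤ := by
    by_contra hne
    obtain ⟨P, hP, hle⟩ := Ideal.exists_le_maximal _ hne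
    obtain ⟨f, hf, ⟨b⟩⟩ :=
      Module.exists_nonempty_basis_away_of_fittingIdeal htop hbot ⟨P, hP.isPrime⟩
    exact hf (hle (Ideal.subset_span (Module.Free.of_basis b)))
  refine Module.FinitePresentation.of_localizationSpan s hs fun g => ?_
  haveI : Module.Free (Localization.Away g.1) (LocalizedModule.Away g.1 M) := g.2
  haveI : Module.Finite (Localization.Away g.1) (LocalizedModule.Away g.1 M) :=
    Module.Finite.of_isLocalizedModule (Submonoid.powers g.1) (LocalizedModule.mkLinearMap _ _)
  exact Module.finitePresentation_of_projective _ _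

/-- **A finite module satisfying the Fitting conditions is projective** (finitely presented and
flat; Lazard, Stacks 058R). [cite: StacksProject, Tag 07ZD] -/
theorem Module.projective_of_fittingIdeal [Module.Finite R M] {r : ℕ}
    (htop : Module.fittingIdeal R M r = ⊤) (hbot : ∀ k < r, Module.fittingIdeal R M k = ⊥) :
    Module.Projective R M := by
  haveI := Module.finitePresentation_of_fittingIdeal htop hbot
  haveI := Module.flat_of_fittingIdeal htop hbot
  exact Module.Flat.projective_of_finitePresentation

/-- **Stacks, Tag 07ZD (More on Algebra, Lemma 15.8.8)** in the currency of Mathlib's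
`Module.Grassmannian` (finite projective of constant `rankAtStalk`): a finite `R`-module `M` is
projective with `rank_𝔭(M) = r` at every prime iff `Fit_r(M) = R` and `Fit_k(M) = 0` for all
`k < r`. [cite: StacksProject, Tag 07ZD] -/
theorem Module.projective_and_rankAtStalk_eq_iff_fittingIdeal [Module.Finite R M] {r : ℕ} :
    (Module.Projective R M ∧ ∀ p : PrimeSpectrum R, Module.rankAtStalk M p = r) ↔
      Module.fittingIdeal R M r = ⊤ ∧ ∀ k < r, Module.fittingIdeal R M k = ⊥ := by
  rw [← Module.flat_and_rankAtStalk_eq_iff_fittingIdeal]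
  refine ⟨fun ⟨hP, hr⟩ => ⟨?_, hr⟩, fun h => ⟨?_, h.2⟩⟩
  · haveI := hP
    exact Module.Flat.of_projective
  · obtain ⟨htop, hbot⟩ := Module.flat_and_rankAtStalk_eq_iff_fittingIdeal.mp h
    exact Module.projective_of_fittingIdeal htop hbot

end Spread

/-! ## §3 Base change: the rank-`r` condition on `S ⊗[R] M` (Stacks 05P8 (3), one `T = Spec S`
at a time) -/

section BaseChange

variable (S : Type w) [CommRing S] [Algebra R S]

/-- **Stacks 05P8 (3), ring form, flat currency**: for a finite `R`-module `M` and an `R`-algebra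
`S`, the base change `S ⊗[R] M` is flat of constant rank `r` over `S` iff `Fit_r(M)·S = S` and
`Fit_k(M)·S = 0` for `k < r` — 07ZD over `S` and `Fit_k(S ⊗ M) = Fit_k(M)·S` (0C3D / 07ZA (3)).
[cite: StacksProject, Tag 05P8] -/
theorem Module.flat_and_rankAtStalk_eq_baseChange_iff [Module.Finite R M] {r : ℕ} :
    (Module.Flat S (S ⊗[R] M) ∧ ∀ q : PrimeSpectrum S, Module.rankAtStalk (S ⊗[R] M) q = r) ↔
      (Module.fittingIdeal R M r).map (algebraMap R S) = ⊤ ∧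
        ∀ k < r, (Module.fittingIdeal R M k).map (algebraMap R S) = ⊥ := by
  rw [Module.flat_and_rankAtStalk_eq_iff_fittingIdeal]
  simp only [Module.fittingIdeal_baseChange]

/-- **Stacks 05P8 (3), ring form, projective currency**: for a finite `R`-module `M` and an
`R`-algebra `S`, `S ⊗[R] M` is projective of constant rank `r` over `S` iff
`Fit_r(M)·S = S` and `Fit_k(M)·S = 0` for `k < r`. [cite: StacksProject, Tag 05P8] -/
theorem Module.projective_and_rankAtStalk_eq_baseChange_iff [Module.Finite R M] {r : ℕ} :
    (Module.Projective S (S ⊗[R] M) ∧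
        ∀ q : PrimeSpectrum S, Module.rankAtStalk (S ⊗[R] M) q = r) ↔
      (Module.fittingIdeal R M r).map (algebraMap R S) = ⊤ ∧
        ∀ k < r, (Module.fittingIdeal R M k).map (algebraMap R S) = ⊥ := by
  rw [Module.projective_and_rankAtStalk_eq_iff_fittingIdeal]
  simp only [Module.fittingIdeal_baseChange]

/-- **Stacks 05P8 (3) as printed** ("`R → S` factors through `R/Fit_{r-1}(M)` and inverts
`Fit_r(M)`"), flat currency: `S ⊗[R] M` is flat of constant rank `r` iff `Fit_r(M)·S = S` and
`Fit_k(M) ⊆ ker (R → S)` for all `k < r`. [cite: StacksProject, Tag 05P8] -/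
theorem Module.flat_and_rankAtStalk_eq_baseChange_iff_le_ker [Module.Finite R M] {r : ℕ} :
    (Module.Flat S (S ⊗[R] M) ∧ ∀ q : PrimeSpectrum S, Module.rankAtStalk (S ⊗[R] M) q = r) ↔
      (Module.fittingIdeal R M r).map (algebraMap R S) = ⊤ ∧
        ∀ k < r, Module.fittingIdeal R M k ≤ RingHom.ker (algebraMap R S) := by
  rw [Module.flat_and_rankAtStalk_eq_baseChange_iff]
  simp only [Ideal.map_eq_bot_iff_le_ker]

/-- **Stacks 05P8 (3) as printed**, projective currency (finite `M`).
[cite: StacksProject, Tag 05P8] -/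
theorem Module.projective_and_rankAtStalk_eq_baseChange_iff_le_ker [Module.Finite R M]
    {r : ℕ} :
    (Module.Projective S (S ⊗[R] M) ∧
        ∀ q : PrimeSpectrum S, Module.rankAtStalk (S ⊗[R] M) q = r) ↔
      (Module.fittingIdeal R M r).map (algebraMap R S) = ⊤ ∧
        ∀ k < r, Module.fittingIdeal R M k ≤ RingHom.ker (algebraMap R S) := by
  rw [Module.projective_and_rankAtStalk_eq_baseChange_iff]
  simp only [Ideal.map_eq_bot_iff_le_ker]

/-- **The strata are disjoint** (Stacks 05P8: `Z_{r-1} ∖ Z_r` for different `r` do not meet): if a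
base change `S ⊗[R] M` to a non-trivial `S` satisfies the rank-`r` and the rank-`r'` Fitting
conditions, then `r = r'`. [cite: StacksProject, Tag 05P8] -/
theorem Module.eq_of_fittingIdeal_map_eq [Module.Finite R M] [Nontrivial S] {r r' : ℕ}
    (h : (Module.fittingIdeal R M r).map (algebraMap R S) = ⊤ ∧
      ∀ k < r, (Module.fittingIdeal R M k).map (algebraMap R S) = ⊥)
    (h' : (Module.fittingIdeal R M r').map (algebraMap R S) = ⊤ ∧
      ∀ k < r', (Module.fittingIdeal R M k).map (algebraMap R S) = ⊥) : r = r' := by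
  obtain ⟨q⟩ := (inferInstance : Nonempty (PrimeSpectrum S))
  rw [← ((Module.flat_and_rankAtStalk_eq_baseChange_iff S).mpr h).2 q,
    ← ((Module.flat_and_rankAtStalk_eq_baseChange_iff S).mpr h').2 q]

end BaseChange

/-! ## §4 Fibre ranks: the points of `V(Fit_{r-1}) ∖ V(Fit_r)` (Stacks 07ZC) -/

section Fiber

/-- **Stacks 07ZC (1) ⇔ (2)**, contrapositive form: for a finite module `M`, a prime `𝔭` and
`k ≥ 0`, `Fit_k(M) ⊆ 𝔭` iff `k < dim_{κ(𝔭)} (κ(𝔭) ⊗_R M)` — base change to the residue field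
(07ZA (3)) and the field case (07Z7). [cite: StacksProject, Tag 07ZC] -/
theorem Module.fittingIdeal_le_iff_lt_finrank_fiber [Module.Finite R M] (p : PrimeSpectrum R)
    (k : ℕ) :
    Module.fittingIdeal R M k ≤ p.asIdeal ↔
      k < Module.finrank p.asIdeal.ResidueField (p.asIdeal.ResidueField ⊗[R] M) := by
  rw [← Module.fittingIdeal_eq_bot_iff_lt_finrank, Module.fittingIdeal_baseChange,
    Ideal.map_eq_bot_iff_le_ker, Ideal.ker_algebraMap_residueField]

/-- **Stacks 07ZC (1) ⇔ (2)**: `Fit_k(M) ⊄ 𝔭` iff `dim_{κ(𝔭)} (κ(𝔭) ⊗_R M) ≤ k` (iff `M_𝔭` is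
generated by `k` elements). [cite: StacksProject, Tag 07ZC] -/
theorem Module.not_fittingIdeal_le_iff_finrank_fiber_le [Module.Finite R M] (p : PrimeSpectrum R)
    (k : ℕ) :
    ¬ Module.fittingIdeal R M k ≤ p.asIdeal ↔
      Module.finrank p.asIdeal.ResidueField (p.asIdeal.ResidueField ⊗[R] M) ≤ k := by
  rw [Module.fittingIdeal_le_iff_lt_finrank_fiber, not_lt]

/-- **The fibre-rank stratification of `Spec R` by the Fitting ideals** (Stacks 05P8, pointwise):
the fibre rank `dim_{κ(𝔭)} (κ(𝔭) ⊗_R M)` of a finite module is `r` exactly at the points of the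
locally closed stratum `V(Fit_{r-1}(M)) ∖ V(Fit_r(M))`, i.e. iff `Fit_k(M) ⊆ 𝔭` for `k < r` and
`Fit_r(M) ⊄ 𝔭`. [cite: StacksProject, Tag 05P8] -/
theorem Module.finrank_fiber_eq_iff_fittingIdeal [Module.Finite R M] (p : PrimeSpectrum R)
    (r : ℕ) :
    Module.finrank p.asIdeal.ResidueField (p.asIdeal.ResidueField ⊗[R] M) = r ↔
      ¬ Module.fittingIdeal R M r ≤ p.asIdeal ∧ ∀ k < r, Module.fittingIdeal R M k ≤ p.asIdeal := by
  rw [Module.not_fittingIdeal_le_iff_finrank_fiber_le]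
  simp only [Module.fittingIdeal_le_iff_lt_finrank_fiber]
  constructor
  · rintro rfl
    exact ⟨le_rfl, fun k hk => hk⟩
  · rintro ⟨hle, hlt⟩
    refine le_antisymm hle (not_lt.mp fun h => ?_)
    exact lt_irrefl _ (hlt _ h)

/-- Under the rank-`r` Fitting conditions the fibre rank is `r` at every prime.
[cite: StacksProject, Tag 07ZD] -/
theorem Module.finrank_fiber_eq_of_fittingIdeal [Module.Finite R M] {r : ℕ}
    (htop : Module.fittingIdeal R M r = ⊤) (hbot : ∀ k < r, Module.fittingIdeal R M k = ⊥)
    (p : PrimeSpectrum R) :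
    Module.finrank p.asIdeal.ResidueField (p.asIdeal.ResidueField ⊗[R] M) = r := by
  refine (Module.finrank_fiber_eq_iff_fittingIdeal p r).mpr ⟨fun h => ?_, fun k hk => ?_⟩
  · rw [htop, top_le_iff] at h
    exact p.2.ne_top h
  · rw [hbot k hk]
    exact bot_le

end Fiber

end Literature.RingTheory.FittingIdeal
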